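import Summits.BirchSwinnertonDyer.BirchSwinnertonDyer.Theorems.TwoAdicConverseGoodOrdAutomaticAtTwo
import Summits.BirchSwinnertonDyer.BirchSwinnertonDyer.Theorems.TwoAdicConverseTwoDivisionCubicMultiplicativePrimes
import Literature.NumberTheory.EllipticCurves.ComplexMultiplicationDeuringFrobeniusProofs
import Literature.NumberTheory.EllipticCurves.TwoAdicImageNonSurjectiveFamiliesProofs
import HarnessLib

/-!
# Route `TwoAdicConverse` (rung S3), crux `OrdLambdaHalfAtTwo` (item 19556), line L2 `f4-semisimple-cubic-two`: the CUBIC-IMAGE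
# stratum (γ₁) «`E[2]` irreducible but `ρ̄_{E,2}` not surjective» in the tree's vocabulary, and its forced local structure —
# `Δ ∈ ℚ×²`, `Δ > 0`, ordinary at every good `2`, and `E[2] ⊂ E(ℚ_v)` for `v = ∞`, `v = 2` (good or multiplicative) and every
# multiplicative `v`

Cell `bsd-2adic`, seat `bsd-2adic-conv-1` (GEN 22). THEOREMS ONLY — no named fact, no definition, nothing conditional, no `sorry`.
HONEST FRAMING: this is card `f4-semisimple-cubic-two` §«Why it bites here (1) STRUCTURE FORCED BY ORDINARITY» assembled BY NAME from
tree theorems (Dokchitser–Dokchitser (1) `hasSurjectiveModNGaloisRep_two_iff`; GEN 21 p638907 / p639351; GEN 22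
`TwoAdicConverseGoodOrdAutomaticAtTwo`, `TwoAdicConverseTwoDivisionCubicMultiplicativePrimes`) — the card's predicate
`HasCubicModTwoImage W := Irr ∧ ¬Surj` is written as the two hypotheses `(hirr : W.HasIrreducibleModPGaloisRep 2)`
`(hns : ¬ W.HasSurjectiveModNGaloisRep 2)`, and its `TwoDivisionSplitsAt W ℓ` as `roots.card = 3` over `ℚ_ℓ`. Nothing about
`λ`-invariants, Selmer groups, `L`-values; items 19556 / 19218 stay OPEN; BSD is not proved by any of this. PARTITION (D-0054): none —
RANK axis (S3) × X5@2 stratum (γ₁); types-the-object-of.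

* §1 dictionary: `Irr ∧ ¬Surj ⟺ (no rational point of order 2) ∧ Δ ∈ ℚ×²` (`irr_and_not_surj_two_iff`); hence `Δ > 0`;
* §2 at `2`: never good supersingular; good ⇒ `GoodOrd` (GEN 22 `goodOrd_two_of_good_of_not_surj`, cited); good or multiplicative ⇒ `ψ₂²` has `3` roots in `ℚ₂` (`E[2] ⊂ E(ℚ₂)`, `2` splits
  completely in `K₃ = ℚ(E[2])`);
* §3 at a multiplicative `ℓ` (any): `3` roots in `ℚ_ℓ`; at `∞`: `3` real roots (one by the intermediate value theorem, then the
  square discriminant);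
* §4 (every `W`, complements to GEN 22's multiplicative-prime file): at an odd multiplicative `ℓ`, `E(ℚ_ℓ)[2] ≠ 0` in POINT form
  (`exists_point_ne_zero_two_nsmul_eq_zero_padic_of_mult_odd`), and the DESK CRITERION `#roots = 3 ⟺ ord_ℓ(Δ_min)` even `∧ Δ_min/ℓ^{ord}`
  a square mod `ℓ` (`card_roots_twoTorsionPolynomial_padic_eq_three_iff_even_and_isSquare_zmod_of_mult_odd`; Serre II.3.3).

References: T. Dokchitser, V. Dokchitser, Math. Z. 272 (2012) Thm (1); J. H. Silverman, *AEC* (2009) III.1, VII.2, VII.5, C.14.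
[DokchitserDokchitserMathZ2012] [SilvermanAEC2009]
-/

set_option linter.dupNamespace false
set_option autoImplicit false

noncomputable section

open scoped Classical
open Polynomial WeierstrassCurve Literature.NumberTheory.EllipticCurves Literature.NumberTheory.EllipticCurves.Greenberg1999
  Literature.NumberTheory.EllipticCurves.Rank1Residual Summit.BirchSwinnertonDyer.Rank1Residual

namespace Summit.BirchSwinnertonDyer.BirchSwinnertonDyer.Theorems.TwoAdicTwistConverse

variable (W : WeierstrassCurve ℚ) [W.IsElliptic] [W.IsGloballyMinimal]

/-! ## §1. The dictionary -/

omit [W.IsGloballyMinimal] in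
/-- **Cubic mod-`2` image ⟺ no rational point of order `2` and `Δ ∈ ℚ×²`** (`ρ̄_{E,2}(G_ℚ) ⊂ A₃ = C₃`, and `≠ 1` because `E[2]`
is irreducible): Dokchitser–Dokchitser (1) (`hasSurjectiveModNGaloisRep_two_iff`) with `irr_two_iff_forall_two_nsmul`.
[cite: DokchitserDokchitserMathZ2012, Theorem (1) (p. 961)] -/
theorem irr_and_not_surj_two_iff :
    (W.HasIrreducibleModPGaloisRep 2 ∧ ¬ W.HasSurjectiveModNGaloisRep 2) ↔
      ((∀ P : W.toAffine.Point, 2 • P = 0 → P = 0) ∧ IsSquare W.Δ) := by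
  haveI : Fact (Nat.Prime 2) := ⟨Nat.prime_two⟩
  rw [hasSurjectiveModNGaloisRep_two_iff W]
  have hirr : W.HasIrreducibleModPGaloisRep 2 ↔ ∀ P : W.toAffine.Point, 2 • P = 0 → P = 0 :=
    X5.O1.irr_two_iff_forall_two_nsmul W
  rw [hirr]
  constructor
  · rintro ⟨h2, hns⟩
    refine ⟨h2, ?_⟩
    by_contra hsq
    exact hns ⟨h2, hsq⟩
  · rintro ⟨h2, hsq⟩
    exact ⟨h2, fun h ↦ h.2 hsq⟩

omit [W.IsGloballyMinimal] in
/-- On the cubic-image stratum `Δ ∈ ℚ×²`. [cite: DokchitserDokchitserMathZ2012, Theorem (1)] -/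
theorem isSquare_Δ_of_irr_of_not_surj (hirr : W.HasIrreducibleModPGaloisRep 2) (hns : ¬ W.HasSurjectiveModNGaloisRep 2) :
    IsSquare W.Δ :=
  ((irr_and_not_surj_two_iff W).mp ⟨hirr, hns⟩).2

omit [W.IsGloballyMinimal] in
/-- On the cubic-image stratum `Δ > 0` (a nonzero rational square): complex conjugation acts through `A₃ ∩ {order ≤ 2} = 1`, so
`E[2] ⊂ E(ℝ)`. [folklore] -/
theorem Δ_pos_of_irr_of_not_surj (hirr : W.HasIrreducibleModPGaloisRep 2) (hns : ¬ W.HasSurjectiveModNGaloisRep 2) :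
    0 < W.Δ := by
  obtain ⟨v, hv⟩ := isSquare_Δ_of_irr_of_not_surj W hirr hns
  have hΔ0 : W.Δ ≠ 0 := W.isUnit_Δ.ne_zero
  rw [hv] at hΔ0 ⊢
  rcases lt_trichotomy v 0 with h | h | h
  · exact mul_pos_of_neg_of_neg h h
  · exact absurd (by rw [h, mul_zero]) hΔ0
  · exact mul_pos h h

omit [W.IsGloballyMinimal] in
/-- On the cubic-image stratum there is no rational `2`-torsion abscissa. [cite: SilvermanAEC2009, III.2.3] -/
theorem not_hasRationalTwoTorsionX_of_irr (hirr : W.HasIrreducibleModPGaloisRep 2) (x : ℚ) : ¬ HasRationalTwoTorsionX W x := by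
  intro hx
  have hroot : W.twoTorsionPolynomial.toPoly.IsRoot x :=
    (isRoot_twoTorsionPolynomial_iff W x).mpr ((hasRationalTwoTorsionX_iff_twoDivision W x).mp hx)
  exact W.not_hasIrreducibleModPGaloisRep_two_of_isRoot_twoTorsionPolynomial hroot hirr

/-! ## §2. At the prime `2` -/

/-- **A cubic-image curve is never good SUPERSINGULAR at `2`** (supersingular `2` forces `ρ̄_{E,2}` onto).
[cite: DokchitserDokchitserMathZ2012, Theorem (1)] -/
theorem not_goodSS_two_of_not_surj (hns : ¬ W.HasSurjectiveModNGaloisRep 2) : ¬ GoodSS W 2 :=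
  fun hss ↦ hns (SSTwoAdicImage.hasSurjectiveModNGaloisRep_two_of_goodSS_two W hss)

/-- **`E[2] ⊂ E(ℚ₂)` on the cubic-image stratum at a good or multiplicative `2`**: `ψ₂²` has `3` roots in `ℚ₂` — `2` splits
completely in the cyclic cubic field `ℚ(E[2])` (card rung (1) `stub_cubicImage_twoDivisionSplitsAt_two`, with `GoodOrd` derived
from good reduction). [cite: SilvermanAEC2009, VII.2] -/
theorem card_roots_twoTorsionPolynomial_padic_two_eq_three_of_irr_of_not_surj
    (h2 : W.HasGoodReductionAtPrime 2 ∨ Mult W 2) (hirr : W.HasIrreducibleModPGaloisRep 2)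
    (hns : ¬ W.HasSurjectiveModNGaloisRep 2) :
    Multiset.card ((W.twoTorsionPolynomial.toPoly).map (algebraMap ℚ ℚ_[2])).roots = 3 := by
  have hΔ := isSquare_Δ_of_irr_of_not_surj W hirr hns
  rcases h2 with hgood | hm
  · exact card_roots_twoTorsionPolynomial_padic_two_eq_three_of_good_of_isSquare W hgood hΔ
  · exact card_roots_twoTorsionPolynomial_padic_two_of_goodOrd_or_mult_of_isSquare W (Or.inr hm) hΔ

/-! ## §3. At the multiplicative primes and at `∞` -/

/-- **`E[2] ⊂ E(ℚ_ℓ)` at EVERY multiplicative prime `ℓ` on the cubic-image stratum** (`ℓ` splits completely in `ℚ(E[2])`; Tate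
curve: the local image is unipotent mod `2`, hence trivial inside `C₃`). [cite: SilvermanAEC2009, VII.5 Prop. 5.1(b) and C.14] -/
theorem card_roots_twoTorsionPolynomial_padic_eq_three_of_mult_of_irr_of_not_surj {ℓ : ℕ} [Fact ℓ.Prime] (hm : Mult W ℓ)
    (hirr : W.HasIrreducibleModPGaloisRep 2) (hns : ¬ W.HasSurjectiveModNGaloisRep 2) :
    Multiset.card ((W.twoTorsionPolynomial.toPoly).map (algebraMap ℚ ℚ_[ℓ])).roots = 3 :=
  card_roots_twoTorsionPolynomial_padic_eq_three_of_mult_of_isSquare W hm (isSquare_Δ_of_irr_of_not_surj W hirr hns)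

omit [W.IsElliptic] [W.IsGloballyMinimal] in
/-- The `2`-division cubic has a real root (intermediate value theorem on `[−A, A]`, `A = 1 + |b₂| + |b₄| + |b₆|`).
-- adapted from `AlignedTransportAtTwoFineRoad.RealHalving.exists_real_root_twoDivisionCubic` (route-cone file; restated here
-- route-free for the S3 Theorems cone). [folklore] -/
theorem exists_real_root_twoDivisionCubic' :
    ∃ x : ℝ, 4 * x ^ 3 + (W.b₂ : ℝ) * x ^ 2 + 2 * (W.b₄ : ℝ) * x + (W.b₆ : ℝ) = 0 := by
  set b₂ : ℝ := (W.b₂ : ℝ)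
  set b₄ : ℝ := (W.b₄ : ℝ)
  set b₆ : ℝ := (W.b₆ : ℝ)
  set A : ℝ := 1 + |b₂| + |b₄| + |b₆| with hA
  have h2 := abs_nonneg b₂
  have h4 := abs_nonneg b₄
  have h6 := abs_nonneg b₆
  have hA0 : 0 ≤ A := by rw [hA]; linarith
  let g : ℝ → ℝ := fun x ↦ 4 * x ^ 3 + b₂ * x ^ 2 + 2 * b₄ * x + b₆
  have hg : Continuous g := by fun_prop
  have hb₂l : -|b₂| * A ^ 2 ≤ b₂ * A ^ 2 := mul_le_mul_of_nonneg_right (neg_abs_le b₂) (sq_nonneg A)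
  have hb₂u : b₂ * A ^ 2 ≤ |b₂| * A ^ 2 := mul_le_mul_of_nonneg_right (le_abs_self b₂) (sq_nonneg A)
  have hb₄l : -|b₄| * A ≤ b₄ * A := mul_le_mul_of_nonneg_right (neg_abs_le b₄) hA0
  have hb₄u : b₄ * A ≤ |b₄| * A := mul_le_mul_of_nonneg_right (le_abs_self b₄) hA0
  have hb₆l : -|b₆| ≤ b₆ := neg_abs_le b₆
  have hb₆u : b₆ ≤ |b₆| := le_abs_self b₆
  have hc₂ : |b₂| * A ^ 2 ≤ A * A ^ 2 := mul_le_mul_of_nonneg_right (by rw [hA]; linarith) (sq_nonneg A)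
  have hc₄ : |b₄| * A ≤ A * A ^ 2 := by
    calc |b₄| * A ≤ A * A := mul_le_mul_of_nonneg_right (by rw [hA]; linarith) hA0
      _ ≤ A * A ^ 2 := by nlinarith
  have hc₆ : |b₆| ≤ A * A ^ 2 := by
    calc |b₆| ≤ A := by rw [hA]; linarith
      _ ≤ A * A ^ 2 := by nlinarith
  have hpos : 0 ≤ g A := by
    change 0 ≤ 4 * A ^ 3 + b₂ * A ^ 2 + 2 * b₄ * A + b₆
    nlinarith
  have hneg : g (-A) ≤ 0 := by
    change 4 * (-A) ^ 3 + b₂ * (-A) ^ 2 + 2 * b₄ * (-A) + b₆ ≤ 0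
    nlinarith
  obtain ⟨x, -, hx⟩ := intermediate_value_Icc (show -A ≤ A by linarith) hg.continuousOn ⟨hneg, hpos⟩
  exact ⟨x, hx⟩

omit [W.IsGloballyMinimal] in
/-- **`Δ > 0` ⇒ the `2`-division cubic has `3` real roots** (`E[2] ⊂ E(ℝ)`): one real root by the intermediate value theorem, and
`Δ` is a square in `ℝ`. [cite: SilvermanAEC2009, III.1] -/
theorem card_roots_twoTorsionPolynomial_real_eq_three_of_Δ_pos (hΔ : 0 < W.Δ) :
    Multiset.card ((W.twoTorsionPolynomial.toPoly).map (algebraMap ℚ ℝ)).roots = 3 := by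
  obtain ⟨r, hr⟩ := exists_real_root_twoDivisionCubic' W
  refine card_roots_twoTorsionPolynomial_eq_three_of_root_of_isSquare W (by simpa using hr) ?_
  refine ⟨Real.sqrt (W.Δ : ℝ), ?_⟩
  rw [← sq, Real.sq_sqrt (by exact_mod_cast hΔ.le)]

omit [W.IsGloballyMinimal] in
/-- **`E[2] ⊂ E(ℝ)` on the cubic-image stratum**: `3` real roots. [cite: SilvermanAEC2009, III.1] -/
theorem card_roots_twoTorsionPolynomial_real_eq_three_of_irr_of_not_surj (hirr : W.HasIrreducibleModPGaloisRep 2)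
    (hns : ¬ W.HasSurjectiveModNGaloisRep 2) :
    Multiset.card ((W.twoTorsionPolynomial.toPoly).map (algebraMap ℚ ℝ)).roots = 3 :=
  card_roots_twoTorsionPolynomial_real_eq_three_of_Δ_pos W (Δ_pos_of_irr_of_not_surj W hirr hns)


/-! ## §4. Complements at an odd multiplicative prime (every `W`) -/

/-- **`E(ℚ_ℓ)[2] ≠ 0` at an odd multiplicative prime, in point form**: the base change of `W` to `ℚ_ℓ` has a point `Q ≠ O` with `2Q = O`
(abscissa = the Hensel root of `ψ₂²`, ordinate `−(a₁x + a₃)/2`). [cite: SilvermanAEC2009, C.14 (Tate curve) and III.2.3] -/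
theorem exists_point_ne_zero_two_nsmul_eq_zero_padic_of_mult_odd {ℓ : ℕ} [Fact ℓ.Prime] (hℓ : ℓ ≠ 2) (hm : Mult W ℓ) :
    ∃ Q : (W.baseChange ℚ_[ℓ]).toAffine.Point, Q ≠ 0 ∧ 2 • Q = 0 := by
  obtain ⟨x, hx⟩ := exists_padic_root_twoDivisionCubic_of_mult_odd W hℓ hm
  set V := W.baseChange ℚ_[ℓ] with hV
  have hb₂ : V.b₂ = (W.b₂ : ℚ_[ℓ]) := by rw [hV, WeierstrassCurve.baseChange, WeierstrassCurve.map_b₂]; simp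
  have hb₄ : V.b₄ = (W.b₄ : ℚ_[ℓ]) := by rw [hV, WeierstrassCurve.baseChange, WeierstrassCurve.map_b₄]; simp
  have hb₆ : V.b₆ = (W.b₆ : ℚ_[ℓ]) := by rw [hV, WeierstrassCurve.baseChange, WeierstrassCurve.map_b₆]; simp
  have h2 : (2 : ℚ_[ℓ]) ≠ 0 := two_ne_zero
  have hx' : 4 * x ^ 3 + V.b₂ * x ^ 2 + 2 * V.b₄ * x + V.b₆ = 0 := by rw [hb₂, hb₄, hb₆]; exact hx
  have hEq : V.toAffine.Equation x (-(V.a₁ * x + V.a₃) / 2) := (equation_line_iff_twoDivision V h2 x).mpr hx'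
  have hns : V.toAffine.Nonsingular x (-(V.a₁ * x + V.a₃) / 2) :=
    (WeierstrassCurve.Affine.equation_iff_nonsingular (W := V.toAffine)).mp hEq
  refine ⟨.some x _ hns, WeierstrassCurve.Affine.Point.some_ne_zero hns, ?_⟩
  rw [WeierstrassCurve.two_nsmul_some_eq_zero_iff_eq_negY]
  simp only [WeierstrassCurve.Affine.negY]
  ring

/-- **Desk criterion at an odd multiplicative prime**: write `Δ_min = ℓᵃ·m` with `ℓ ∤ m`; then `ψ₂²` has `3` roots in `ℚ_ℓ` (i.e. `ℓ` splits
completely in `ℚ(E[2])`, `E[2] ⊂ E(ℚ_ℓ)`) iff `a` is EVEN and `m` is a SQUARE mod `ℓ` — otherwise exactly one root. (For split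
multiplicative reduction `a = c_ℓ`, the Tamagawa number.) [cite: Serre1973, Ch. II §3.3 Thm 3] [cite: SilvermanAEC2009, C.14] -/
theorem card_roots_twoTorsionPolynomial_padic_eq_three_iff_even_and_isSquare_zmod_of_mult_odd {ℓ : ℕ} [Fact ℓ.Prime] (hℓ : ℓ ≠ 2)
    (hm : Mult W ℓ) {a : ℕ} {m : ℤ} (hΔ : minimalDiscriminantInt W = (ℓ : ℤ) ^ a * m) (hmℓ : ¬ (ℓ : ℤ) ∣ m) :
    Multiset.card ((W.twoTorsionPolynomial.toPoly).map (algebraMap ℚ ℚ_[ℓ])).roots = 3 ↔ Even a ∧ IsSquare ((m : ℤ) : ZMod ℓ) := by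
  rw [card_roots_twoTorsionPolynomial_padic_eq_three_iff_of_mult_odd W hℓ hm, ← cast_minimalDiscriminantInt W, Rat.cast_intCast]
  constructor
  · intro h
    obtain ⟨ha, hu⟩ := GaloisImage.PadicSquareClass.even_and_isSquare_unit_of_isSquare (p := ℓ) hΔ hmℓ h
    exact ⟨Nat.even_iff.mpr ha, DeuringLadic.isSquare_zmod_of_isSquare_padic hu⟩
  · rintro ⟨⟨b, hb⟩, hsq⟩
    obtain ⟨s, hs⟩ := GaloisImage.PadicSquareClass.isSquare_intCast_padic_of_isSquare_zmod (p := ℓ) hℓ hmℓ hsq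
    refine ⟨(ℓ : ℚ_[ℓ]) ^ b * s, ?_⟩
    rw [hΔ]
    push_cast
    rw [hb, pow_add, hs]
    ring

end Summit.BirchSwinnertonDyer.BirchSwinnertonDyer.Theorems.TwoAdicTwistConverse

end
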